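import Literature.MathematicalPhysics.QuantumFieldTheory.Balaban1983to89.B9Eq319QprimeTorus
import Literature.MathematicalPhysics.QuantumFieldTheory.Balaban1983to89.B9SectCLatticeCarrier

/-!
# `Balaban1983to89.B9Eq349BlockReadingAdapter` — T. Bałaban, *Propagators for lattice gauge theories in a background field*, Commun. Math.
# Phys. **99** (1985) 389–434 [Balaban1985BackgroundPropagators] (3.15)∕(3.16) p. 393, (3.49) p. 399: **THE NEXT-BLOCK READING OF A CUT-OFF PAIR
# FROM THE SAME-BLOCK READING AND THE FINE LIPSCHITZ LETTER** — if `|χ(b₋) − χ(b₊)| ≤ θ` on every fine bond and `|χ′(y) − χ(x)| ≤ ℓ′` for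
# `x ∈ B(y)`, then `|χ′(y) − χ(x)| ≤ ℓ′ + L·θ` for `x` in `B(y)` OR in the next block `B(y + e_i)` along any direction `i`
# (built by ne9-leaf-06 gen 81 as OFFER O-leaf06-g81-1; filed by gen 82 on the consumer's word — ne9-leaf-03 g76 «WANTED» [NE9LEAF03-G76-WANTED-1]
# + INTERFACE REQUEST [NE9LEAF03-G76-IFREQ-1], the FREEZE e34b3e0c (0) crux-consumer request protocol)

statement-level skeleton of published theorems with citation tags; proofs where landed; nothing here is a claim about the Yang–Mills mass gap

CITATION HEADER (lean-in-tree rule).  Audit cell `pub-balaban`, sub-cell `t4`, BINDER row NE9 (road ΔA-CT ∕ the OWNER's conjugation letters).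
WHY: the OWNER t4-ne9-p1's `Q(U)` conjugation letters (`B9Eq349ConjugatedQLetters`, `…QTowerLetters`) read the coarse cut-off against the fine one on
the SAME block and on the NEXT block along the bond (`blockCoord b.1 = c.1 ∨ blockCoord b.1 = shift c.2 c.1`), while the consumers' displayed letter
`hQK` ((QGD)∕(H1D)∕(EH1) and tower ports) carries the same-block reading only; this file is the adapter `ℓ′ ↦ ℓ′ + L·θ` (with θ = ℓη and ηL^{n+1} = 1:
`ℓ′ + ℓ`, height-free).  CONSUMERS of record: ne9-leaf-03's road ΔA-CT — (QGD)∕(H1D)∕(EH1) and the tower ports, (GBD v2)∕(GBT2 v2) — keep their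
displayed same-block `hQK` and bridge to the OWNER's letters through `nextBlock_reading`.  Sources READ first-hand earlier in the lineage:
[Balaban1985BackgroundPropagators] p. 393 (3.15)∕(3.16) (blocks), p. 399 (3.49).

WHAT IS PROVED (sorry-free; [folklore] lattice bookkeeping, Mathlib + the tree's torus∕bond carriers only).
* §1 `shift_iterate_apply_ne` ∕ `shift_iterate_apply_val` (straight paths), `abs_sub_iterate_shift_le` (telescoping: `|χ x − χ (x + n e_k)| ≤ n·θ`).
* §2 `exists_iterate_shift_eq_of_nextBlock` (from the last site of `B(y)` in direction `i`, `≤ L` forward steps reach any site of `B(y + e_i)`),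
  **`nextBlock_reading`** (`|χ′ c.1 − χ b.1| ≤ ℓ′ + L·θ` under the supplier's `∨ shift` hypothesis shape).
HONEST SCOPE.  Bookkeeping; nothing of [B9] asserted; NOT NE9 (cell pub-balaban: NE9 NOT PRINTED ∕ NOT PROVED; «NE9 ⇐ the named binders»; row WALLED ON
A MODEL (O-NE9-1; #5 UNRULED); spine PROVED 0∕9; rung (B)+1 on a finite T⁴ — NOT infinite volume, NOT mass gap, NOT BetaPertH, NOT Clay).  NEW file.
-/

namespace Literature.MathematicalPhysics.QuantumFieldTheory.Balaban1983to89.B9Eq349BlockReadingAdapter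

open B4Sect5Torus (TSite)
open B9SectCLatticeCarrier (Bond bpos btgt shift shift_apply_val shift_apply_ne)
open B9Eq319QprimeTorus (fineP blockCoord mem_blockOf_iff blockCoord_apply_val)

variable {d : ℕ} {Pd : Fin d → ℕ}

/-! ## §1 Straight lattice paths -/

/-- a straight path in direction `k` leaves the other coordinates alone. [folklore] [cite: Balaban1985BackgroundPropagators, (3.15) p.393] -/
theorem shift_iterate_apply_ne {k i : Fin d} (h : i ≠ k) (n : ℕ) (x : TSite d Pd) : ((shift k)^[n] x) i = x i := by
  induction n with
  | zero => rfl
  | succ n ih => rw [Function.iterate_succ_apply', shift_apply_ne h, ih]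

/-- a straight path of `n` steps in direction `k` advances that coordinate by `n` (mod the period). [folklore]
[cite: Balaban1985BackgroundPropagators, (3.15) p.393] -/
theorem shift_iterate_apply_val (k : Fin d) (n : ℕ) (x : TSite d Pd) : (((shift k)^[n] x) k).val = ((x k).val + n) % Pd k := by
  induction n with
  | zero => rw [Function.iterate_zero, id, Nat.add_zero, Nat.mod_eq_of_lt (x k).isLt]
  | succ n ih => rw [Function.iterate_succ_apply', shift_apply_val, ih, Nat.mod_add_mod, Nat.add_assoc]

/-- **TELESCOPING ALONG A STRAIGHT PATH**: a bond-Lipschitz function changes by at most `n·θ` along `n` steps. [folklore]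
[cite: Balaban1985BackgroundPropagators, (3.49) p.399] -/
theorem abs_sub_iterate_shift_le {χ : TSite d Pd → ℝ} {θ : ℝ} (k : Fin d)
    (hχ : ∀ b : Bond d Pd, |χ (bpos b) - χ (btgt b)| ≤ θ) (n : ℕ) (x : TSite d Pd) :
    |χ x - χ ((shift k)^[n] x)| ≤ n * θ := by
  induction n with
  | zero => simp
  | succ n ih =>
    rw [Function.iterate_succ_apply']
    have hb := hχ ((shift k)^[n] x, k)
    calc |χ x - χ (shift k ((shift k)^[n] x))|
        ≤ |χ x - χ ((shift k)^[n] x)| + |χ ((shift k)^[n] x) - χ (shift k ((shift k)^[n] x))| := abs_sub_le _ _ _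
      _ ≤ n * θ + θ := add_le_add ih hb
      _ = ((n + 1 : ℕ) : ℝ) * θ := by push_cast; ring

/-! ## §2 The next block is `≤ L` straight steps away from the last site of the block -/

section Blocks

variable {L : ℕ} [NeZero L] {m : Fin d → ℕ}

/-- **REACHING THE NEXT BLOCK**: for a fine site `x` with `blockCoord x = y + e_i`, the site `x₀ ∈ B(y)` obtained by moving `x`'s `i`-th
coordinate to the last site of `B(y)` reaches `x` in `n ≤ L` forward steps in direction `i` (with the torus wrap when `y_i + 1 = m_i`).
[folklore] [cite: Balaban1985BackgroundPropagators, (3.15)∕(3.16) p.393] -/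
theorem exists_iterate_shift_eq_of_nextBlock (y : TSite d m) (i : Fin d) (x : TSite d (fineP L m))
    (hx : blockCoord L m x = shift i y) :
    ∃ x₀ : TSite d (fineP L m), blockCoord L m x₀ = y ∧ ∃ n : ℕ, n ≤ L ∧ (shift i)^[n] x₀ = x := by
  have hLpos : 0 < L := Nat.pos_of_ne_zero (NeZero.ne L)
  have hyi : (y i).val < m i := (y i).isLt
  obtain ⟨P, hP⟩ : ∃ P : ℕ, P = L * (y i).val := ⟨_, rfl⟩
  have hPm : P + L ≤ L * m i := by
    rw [hP, ← Nat.mul_succ]; exact Nat.mul_le_mul_left _ hyi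
  let x₀ : TSite d (fineP L m) := Function.update x i ⟨P + (L - 1), by show P + (L - 1) < L * m i; omega⟩
  have hx₀i : (x₀ i).val = P + (L - 1) := by simp [x₀]
  have hx₀j : ∀ j, j ≠ i → x₀ j = x j := fun j hj => by simp [x₀, Function.update_of_ne hj]
  refine ⟨x₀, ?_, ?_⟩
  · -- `x₀ ∈ B(y)`
    funext j
    apply Fin.ext
    rw [blockCoord_apply_val]
    by_cases hj : j = i
    · subst hj
      rw [hx₀i, hP, show L * (y j).val + (L - 1) = (L - 1) + L * (y j).val by ring, Nat.add_mul_div_left _ _ hLpos,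
        Nat.div_eq_of_lt (by omega), zero_add]
    · rw [hx₀j j hj]
      have h := congrFun hx j
      rw [shift_apply_ne hj] at h
      rw [← h, blockCoord_apply_val]
  · -- the number of steps
    have hv : (x i).val < L * m i := (x i).isLt
    have hq : (x i).val / L = ((y i).val + 1) % m i := by
      have h := congrArg Fin.val (congrFun hx i)
      rw [blockCoord_apply_val, shift_apply_val] at h
      exact h
    have hdiv := Nat.div_add_mod (x i).val L
    have hmodL : (x i).val % L < L := Nat.mod_lt _ hLpos
    rcases Nat.lt_or_ge ((y i).val + 1) (m i) with hlt | hge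
    · -- no wrap: `x_i ∈ [L(y_i+1), L(y_i+1) + L)`
      rw [Nat.mod_eq_of_lt hlt] at hq
      have hlo : P + L ≤ (x i).val := by
        have : L * ((x i).val / L) ≤ (x i).val := Nat.mul_div_le _ _
        rw [hq, Nat.mul_succ, ← hP] at this; exact this
      have hhi : (x i).val < P + L + L := by
        have : (x i).val < L * ((x i).val / L) + L := by omega
        rw [hq, Nat.mul_succ, ← hP] at this; exact this
      refine ⟨(x i).val + 1 - (P + L), by omega, ?_⟩
      funext j
      by_cases hj : j = i
      · subst hj
        apply Fin.ext
        rw [shift_iterate_apply_val, hx₀i, show P + (L - 1) + ((x j).val + 1 - (P + L)) = (x j).val by omega]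
        exact Nat.mod_eq_of_lt hv
      · rw [shift_iterate_apply_ne hj, hx₀j j hj]
    · -- wrap: `y_i + 1 = m_i`, the next block is block `0`, `x_i ∈ [0, L)`
      have he : (y i).val + 1 = m i := le_antisymm hyi hge
      rw [he, Nat.mod_self] at hq
      have hxlt : (x i).val < L := by
        have : (x i).val < L * ((x i).val / L) + L := by omega
        rw [hq, Nat.mul_zero, zero_add] at this; exact this
      have hPL : P + L = L * m i := by
        calc P + L = L * ((y i).val + 1) := by rw [hP, Nat.mul_succ]
          _ = L * m i := by rw [he]
      refine ⟨(x i).val + 1, by omega, ?_⟩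
      funext j
      by_cases hj : j = i
      · subst hj
        apply Fin.ext
        rw [shift_iterate_apply_val, hx₀i, show P + (L - 1) + ((x j).val + 1) = L * m j + (x j).val by omega]
        rw [Nat.add_mod_left]
        exact Nat.mod_eq_of_lt hv
      · rw [shift_iterate_apply_ne hj, hx₀j j hj]

/-- **THE NEXT-BLOCK READING** (the adapter): `|χ(b₋) − χ(b₊)| ≤ θ` on every fine bond, `|χ′ y − χ x| ≤ ℓ′` for `x ∈ B(y)`, `0 ≤ θ` ⟹ for every coarse bond
`c` and fine bond `b` with `blockCoord b₋ = c₋` OR `blockCoord b₋ = c₋ + e_{c.2}`: `|χ′(c₋) − χ(b₋)| ≤ ℓ′ + L·θ` — the hypothesis shape `hχ'` of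
`B9Eq349ConjugatedQLetters` ∕ `B9Eq349ConjugatedQTowerLetters` from the consumers' same-block premise. [folklore]
[cite: Balaban1985BackgroundPropagators, (3.15)∕(3.16) p.393, (3.49) p.399] -/
theorem nextBlock_reading {χ : TSite d (fineP L m) → ℝ} {χ' : TSite d m → ℝ} {θ ℓ' : ℝ} (hθ : 0 ≤ θ)
    (hχ : ∀ b : Bond d (fineP L m), |χ (bpos b) - χ (btgt b)| ≤ θ)
    (hχ' : ∀ (y : TSite d m), ∀ x ∈ B9Eq319QprimeTorus.blockOf L m y, |χ' y - χ x| ≤ ℓ')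
    (c : Bond d m) (b : Bond d (fineP L m)) (hb : blockCoord L m b.1 = c.1 ∨ blockCoord L m b.1 = shift c.2 c.1) :
    |χ' c.1 - χ b.1| ≤ ℓ' + L * θ := by
  have hL0 : 0 ≤ (L : ℝ) * θ := by positivity
  rcases hb with h | h
  · exact (hχ' c.1 b.1 ((mem_blockOf_iff L m _ _).2 h)).trans (le_add_of_nonneg_right hL0)
  · obtain ⟨x₀, hx₀, n, hn, hreach⟩ := exists_iterate_shift_eq_of_nextBlock c.1 c.2 b.1 h
    have h1 := hχ' c.1 x₀ ((mem_blockOf_iff L m _ _).2 hx₀)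
    have h2 := abs_sub_iterate_shift_le c.2 hχ n x₀
    rw [hreach] at h2
    calc |χ' c.1 - χ b.1| ≤ |χ' c.1 - χ x₀| + |χ x₀ - χ b.1| := abs_sub_le _ _ _
      _ ≤ ℓ' + n * θ := add_le_add h1 h2
      _ ≤ ℓ' + L * θ := by
          have hnL : (n : ℝ) ≤ L := by exact_mod_cast hn
          nlinarith

end Blocks

end Literature.MathematicalPhysics.QuantumFieldTheory.Balaban1983to89.B9Eq349BlockReadingAdapter
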